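import Literature.NumberTheory.Automorphic.PairLFunctionPolesEqConjOneFamily
import Literature.NumberTheory.Automorphic.PairLFunctionPolesRealMoments
import Literature.NumberTheory.Automorphic.PairLFunctionConjHolomorphy
import HarnessLib

/-!
# Arthur–Clozel (2.3) from one real-moment Rankin–Selberg datum per cuspidal representation

Topic `NumberTheory/Automorphic`; namespace `Literature.NumberTheory.Automorphic`. Assembly file
(theorems only: no definition, no named fact, no instance) under the named fact
`JacquetShalika1981_partialPairL_pole_of_eq_conj` of `PairLFunctionPoles` — Arthur–Clozel,
*Simple algebras, base change, and the advanced theory of the trace formula*, Ann. of Math.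
Stud. 120 (1989), Ch. 3 §2, (2.3), p. 171 ("the limit `lim_{s → 1, Re s > 1} (s - 1) L^S(s, π ⊗ σ)`
exists and is finite and non-zero" for `π ≅ σ̃`; "cf. [Jacquet–Shalika II, Prop. 3.6]").

It composes the three proved reductions of the real-point route,

* `PairLFunctionPolesEqConjOneFamily` — the fact for all `(π = σ̄, S, α, β)` from **one** datum per
  cuspidal `σ`: a finite `S₀`, a Satake family `β₀` of `σ` off `S₀` and the pole of
  `(s - 1) L^{S₀}(s, β̄₀ ⊗ β₀)` (change of `S`, uniqueness of Hecke–Satake parameters; the strict bound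
  `|a| < q_v^{1/2}` of Jacquet–Shalika's Cor. (2.5), a theorem of the tree in ranks `n ≤ 2`);
* `PairLFunctionPolesRealMoments` — that pole from a function `I` holomorphic on the strip
  `1 < Re s < 2` with `(s - 1) I(s) → r ≠ 0` at `1`, an identity
  `I(σ) = κ · (∫⁻ g w^σ).toReal · L(σ)` at **real** `1 < σ < 2` with `[0, ∞]`-valued moments of one
  fixed `g ≥ 0` against a weight `w > 0`, all finite for `σ > 1`, the **first moment `∫⁻ g w`
  finite**, and `L` holomorphic on the strip (`exists_ne_zero_tendsto_sub_one_mul_of_real_lmoments_strip`);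
* `PairLFunctionConjHolomorphy` — `L^{S₀}(s, β̄₀ ⊗ β₀)` *is* holomorphic on `Re s > 1`, unconditionally
  (`differentiableOn_partialPairL_conjFamily_left`),

into the statement of what the global Rankin–Selberg method still has to deliver for
`JacquetShalika1981_partialPairL_pole_of_eq_conj_holds`, in the currency in which the tree's
Rankin–Selberg files produce it (`ℝ≥0∞`-valued torus integrals at real points):

**for every cuspidal `σ` of `GL_n(𝔸_K)` (`n ≥ 1`): a finite set `S₀` of finite places, a Satake
family `β₀` of `σ` off `S₀`, a function `I` holomorphic on the strip `1 < Re s < 2` with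
`(s - 1) I(s) → r ≠ 0` (`s → 1`, `Re s > 1`) — in the tree the global integral `∫ φ̄ φ E(·, Φ; s)` of
a smoothed vector of `σ`, whose residue is `RankinSelbergResidueDatum` and whose holomorphy on the
strip follows from the uniform bounds of `RankinSelbergIntegralLine` — a measure space with
measurable `g ≥ 0`, `w > 0` and `κ ≠ 0` such that
`I(σ') = κ · (∫⁻ g w^{σ'}).toReal · L^{S₀}(σ', β̄₀ ⊗ β₀)` at every real `1 < σ' < 2`
(unfolding `WhittakerTowerParseval`, integration over the centre, and the Euler factorisation of the
torus integral off `S₀` with the unramified computation — `g = |W_φ|² Φ δ_B⁻¹` on the `S₀ ∪ S_∞`-part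
of the torus times `K`, `w = |det|`), all moments `∫⁻ g w^{σ'}` (`σ' > 1`) finite
(`RankinSelbergTowerFiniteness`) and the first moment `∫⁻ g w` finite (absolute convergence of the
remaining local integrals at `s = 1`: Jacquet–Shalika I, §§1, 3; Cogdell (2004), Thm. 3.2 (1)).**

* `JacquetShalika1981_partialPairL_pole_of_eq_conj_of_real_moment_datum` — the fact from such data
  and the strict bound (hypothesis `hlt`, every `n`);
* `…_of_real_moment_datum_of_normLt` — the strict bound fed from the local Cor. (2.5) alone;
* `…_of_real_moment_datum_of_le_two` — **in ranks `n ≤ 2` the fact follows from the data alone**;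
* primed versions accept the identity with `L^{S₀}(σ', β₀ ⊗ β̄₀)` (the order of Lemma (5.2)).

## References

* J. Arthur, L. Clozel, *Simple algebras, base change, and the advanced theory of the trace
  formula*, Ann. of Math. Stud. 120 (1989), Ch. 3 §2, (2.1)–(2.3), p. 171. [ArthurClozelAMS120]
* H. Jacquet, J. A. Shalika, *On Euler products and the classification of automorphic
  representations I*, Amer. J. Math. 103 (1981), 499–558, §§1, 3, 4, Cor. (2.5), Thm. (5.3)
  [JacquetShalikaAJM1981]; *II*, Amer. J. Math. 103 (1981), 777–815, §3, Prop. 3.6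
  [JacquetShalikaAJM1981II].
* J. W. Cogdell, *Analytic theory of `L`-functions for `GL_n`*, in *An Introduction to the Langlands
  Program* (2004), §2.3, Thm. 3.2, §4.2. [CogdellAnalyticTheory2004]
-/

noncomputable section

open scoped Topology ENNReal
open NumberField IsDedekindDomain MeasureTheory Filter Complex

namespace Literature.NumberTheory.Automorphic

open AdelicGroupData

section Assembly

variable {n : ℕ} {K : Type} [Field K] [NumberField K]
  {μ : Measure (gl n K).automorphicQuotient} [(gl n K).IsAutomorphicMeasure μ]

/-- **Arthur–Clozel (2.3) from one real-moment Rankin–Selberg datum per cuspidal `σ`** (every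
rank; the strict bound `|a| < q_v^{1/2}` of Jacquet–Shalika's Cor. (2.5) as hypothesis `hlt`). The
datum for `σ = P'`: a finite `S₀`, a Satake family `β₀` of `σ` off `S₀`; `I` holomorphic on the
strip `1 < Re s < 2` with `(s - 1) I(s) → r ≠ 0` at `1` from `Re s > 1`; a measure space `(X, m)`
with measurable `g : X → [0, ∞]`, `w : X → ℝ`, `w > 0`, and `κ ≠ 0`, such that all moments
`∫⁻ g w^{σ'}`, `σ' > 1`, are finite, the first moment `∫⁻ g w` is finite, and
`I(σ') = κ · (∫⁻ g w^{σ'}).toReal · L^{S₀}(σ', β̄₀ ⊗ β₀)` at every real `1 < σ' < 2`. Proof: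
`exists_ne_zero_tendsto_sub_one_mul_of_real_lmoments_strip` (with `differentiableOn_partialPairL_conjFamily_left`
for the holomorphy of `L^{S₀}(s, β̄₀ ⊗ β₀)`) gives the one-family pole datum, and
`JacquetShalika1981_partialPairL_pole_of_eq_conj_of_one_family` (with (2.1)
`JacquetShalika1981_multipliable_partialPairL_holds`) the fact. [cite: ArthurClozelAMS120, Ch. 3 §2 (2.3)] -/
theorem JacquetShalika1981_partialPairL_pole_of_eq_conj_of_real_moment_datum
    (hlt : ∀ (P : CuspidalAutomorphicRepGL n K μ) {S : Set (HeightOneSpectrum (𝓞 K))}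
      {α : SatakeFamily K} (_hα : IsSatakeFamilyOf P S α) {v : HeightOneSpectrum (𝓞 K)}
      (_hv : v ∉ S) {a : ℂ} (_ha : a ∈ α v), ‖a‖ < Real.sqrt v.residueCard)
    (hdat : ∀ (_hn : 0 < n) (P' : CuspidalAutomorphicRepGL n K μ),
      ∃ (S₀ : Set (HeightOneSpectrum (𝓞 K))) (β₀ : SatakeFamily K), S₀.Finite ∧
        IsSatakeFamilyOf P' S₀ β₀ ∧
        ∃ (X : Type) (_ : MeasurableSpace X) (m : Measure X) (g : X → ℝ≥0∞) (w : X → ℝ)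
          (I : ℂ → ℂ) (r κ : ℂ),
          r ≠ 0 ∧ κ ≠ 0 ∧ DifferentiableOn ℂ I {s : ℂ | 1 < s.re ∧ s.re < 2} ∧
          Tendsto (fun s => (s - 1) * I s) (𝓝[{s : ℂ | 1 < s.re}] 1) (𝓝 r) ∧
          Measurable g ∧ Measurable w ∧ (∀ x, 0 < w x) ∧
          (∀ σ' : ℝ, 1 < σ' → ∫⁻ x, g x * ENNReal.ofReal (w x ^ σ') ∂m ≠ ∞) ∧
          ∫⁻ x, g x * ENNReal.ofReal (w x) ∂m ≠ ∞ ∧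
          ∀ σ' : ℝ, 1 < σ' → σ' < 2 →
            I σ' = κ * ((∫⁻ x, g x * ENNReal.ofReal (w x ^ σ') ∂m).toReal : ℝ) *
              partialPairL S₀ (conjFamily β₀) β₀ σ') :
    JacquetShalika1981_partialPairL_pole_of_eq_conj (n := n) (K := K) (μ := μ) := by
  refine JacquetShalika1981_partialPairL_pole_of_eq_conj_of_one_family
    JacquetShalika1981_multipliable_partialPairL_holds hlt fun hn P' => ?_
  obtain ⟨S₀, β₀, hS₀, hβ₀, X, _, m, g, w, I, r, κ, hr, hκ, hIhol, hI, hg, hw, hw0, hfin, h1, hid⟩ :=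
    hdat hn P'
  exact ⟨S₀, β₀, hS₀, hβ₀, exists_ne_zero_tendsto_sub_one_mul_of_real_lmoments_strip hr hκ hIhol
    ((differentiableOn_partialPairL_conjFamily_left P' hβ₀).mono fun s hs => hs.1) hI hg hw hw0 hfin
    h1 hid⟩

/-- The same with the identity in the order `L^{S₀}(σ', β₀ ⊗ β̄₀)` of Jacquet–Shalika's Lemma (5.2)
(`partialPairL S₀ β₀ (conjFamily β₀)`; `differentiableOn_partialPairL_conjFamily`,
`JacquetShalika1981_partialPairL_pole_of_eq_conj_of_one_family'`). [cite: ArthurClozelAMS120, Ch. 3 §2 (2.3)] -/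
theorem JacquetShalika1981_partialPairL_pole_of_eq_conj_of_real_moment_datum'
    (hlt : ∀ (P : CuspidalAutomorphicRepGL n K μ) {S : Set (HeightOneSpectrum (𝓞 K))}
      {α : SatakeFamily K} (_hα : IsSatakeFamilyOf P S α) {v : HeightOneSpectrum (𝓞 K)}
      (_hv : v ∉ S) {a : ℂ} (_ha : a ∈ α v), ‖a‖ < Real.sqrt v.residueCard)
    (hdat : ∀ (_hn : 0 < n) (P' : CuspidalAutomorphicRepGL n K μ),
      ∃ (S₀ : Set (HeightOneSpectrum (𝓞 K))) (β₀ : SatakeFamily K), S₀.Finite ∧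
        IsSatakeFamilyOf P' S₀ β₀ ∧
        ∃ (X : Type) (_ : MeasurableSpace X) (m : Measure X) (g : X → ℝ≥0∞) (w : X → ℝ)
          (I : ℂ → ℂ) (r κ : ℂ),
          r ≠ 0 ∧ κ ≠ 0 ∧ DifferentiableOn ℂ I {s : ℂ | 1 < s.re ∧ s.re < 2} ∧
          Tendsto (fun s => (s - 1) * I s) (𝓝[{s : ℂ | 1 < s.re}] 1) (𝓝 r) ∧
          Measurable g ∧ Measurable w ∧ (∀ x, 0 < w x) ∧
          (∀ σ' : ℝ, 1 < σ' → ∫⁻ x, g x * ENNReal.ofReal (w x ^ σ') ∂m ≠ ∞) ∧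
          ∫⁻ x, g x * ENNReal.ofReal (w x) ∂m ≠ ∞ ∧
          ∀ σ' : ℝ, 1 < σ' → σ' < 2 →
            I σ' = κ * ((∫⁻ x, g x * ENNReal.ofReal (w x ^ σ') ∂m).toReal : ℝ) *
              partialPairL S₀ β₀ (conjFamily β₀) σ') :
    JacquetShalika1981_partialPairL_pole_of_eq_conj (n := n) (K := K) (μ := μ) := by
  refine JacquetShalika1981_partialPairL_pole_of_eq_conj_of_one_family'
    JacquetShalika1981_multipliable_partialPairL_holds hlt fun hn P' => ?_
  obtain ⟨S₀, β₀, hS₀, hβ₀, X, _, m, g, w, I, r, κ, hr, hκ, hIhol, hI, hg, hw, hw0, hfin, h1, hid⟩ :=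
    hdat hn P'
  exact ⟨S₀, β₀, hS₀, hβ₀, exists_ne_zero_tendsto_sub_one_mul_of_real_lmoments_strip hr hκ hIhol
    ((differentiableOn_partialPairL_conjFamily P' hβ₀).mono fun s hs => hs.1) hI hg hw hw0 hfin h1 hid⟩

/-- **The fact from the data and Jacquet–Shalika's local Cor. (2.5) alone** (the strict bound through
`norm_satakeParameter_lt_sqrt_of_normLt`: local components, their genericity and Flath's dictionary
are theorems of the tree). [cite: ArthurClozelAMS120, Ch. 3 §2 (2.3)] -/
theorem JacquetShalika1981_partialPairL_pole_of_eq_conj_of_real_moment_datum_of_normLt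
    (hB : ∀ (v : HeightOneSpectrum (𝓞 K)) {V : Type} [AddCommGroup V] [Module ℂ V]
      (ρ : Representation ℂ (GL (Fin n) (v.adicCompletion K)) V),
      JacquetShalika1981_norm_lt_sqrt_of_isGeneric ρ)
    (hdat : ∀ (_hn : 0 < n) (P' : CuspidalAutomorphicRepGL n K μ),
      ∃ (S₀ : Set (HeightOneSpectrum (𝓞 K))) (β₀ : SatakeFamily K), S₀.Finite ∧
        IsSatakeFamilyOf P' S₀ β₀ ∧
        ∃ (X : Type) (_ : MeasurableSpace X) (m : Measure X) (g : X → ℝ≥0∞) (w : X → ℝ)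
          (I : ℂ → ℂ) (r κ : ℂ),
          r ≠ 0 ∧ κ ≠ 0 ∧ DifferentiableOn ℂ I {s : ℂ | 1 < s.re ∧ s.re < 2} ∧
          Tendsto (fun s => (s - 1) * I s) (𝓝[{s : ℂ | 1 < s.re}] 1) (𝓝 r) ∧
          Measurable g ∧ Measurable w ∧ (∀ x, 0 < w x) ∧
          (∀ σ' : ℝ, 1 < σ' → ∫⁻ x, g x * ENNReal.ofReal (w x ^ σ') ∂m ≠ ∞) ∧
          ∫⁻ x, g x * ENNReal.ofReal (w x) ∂m ≠ ∞ ∧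
          ∀ σ' : ℝ, 1 < σ' → σ' < 2 →
            I σ' = κ * ((∫⁻ x, g x * ENNReal.ofReal (w x ^ σ') ∂m).toReal : ℝ) *
              partialPairL S₀ (conjFamily β₀) β₀ σ') :
    JacquetShalika1981_partialPairL_pole_of_eq_conj (n := n) (K := K) (μ := μ) :=
  JacquetShalika1981_partialPairL_pole_of_eq_conj_of_real_moment_datum
    (fun P _ _ hα _ hv _ ha => norm_satakeParameter_lt_sqrt_of_normLt hB P hα hv ha) hdat

/-- **In ranks `n ≤ 2`, Arthur–Clozel's (2.3) follows from the real-moment data alone** (Cor. (2.5)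
is a theorem of the tree there, `norm_satakeParameter_lt_sqrt_of_le_two`). This is the precise
remaining target of the real-point Rankin–Selberg route for `GL₁`, `GL₂`.
[cite: ArthurClozelAMS120, Ch. 3 §2 (2.3)] -/
theorem JacquetShalika1981_partialPairL_pole_of_eq_conj_of_real_moment_datum_of_le_two (h2 : n ≤ 2)
    (hdat : ∀ (_hn : 0 < n) (P' : CuspidalAutomorphicRepGL n K μ),
      ∃ (S₀ : Set (HeightOneSpectrum (𝓞 K))) (β₀ : SatakeFamily K), S₀.Finite ∧
        IsSatakeFamilyOf P' S₀ β₀ ∧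
        ∃ (X : Type) (_ : MeasurableSpace X) (m : Measure X) (g : X → ℝ≥0∞) (w : X → ℝ)
          (I : ℂ → ℂ) (r κ : ℂ),
          r ≠ 0 ∧ κ ≠ 0 ∧ DifferentiableOn ℂ I {s : ℂ | 1 < s.re ∧ s.re < 2} ∧
          Tendsto (fun s => (s - 1) * I s) (𝓝[{s : ℂ | 1 < s.re}] 1) (𝓝 r) ∧
          Measurable g ∧ Measurable w ∧ (∀ x, 0 < w x) ∧
          (∀ σ' : ℝ, 1 < σ' → ∫⁻ x, g x * ENNReal.ofReal (w x ^ σ') ∂m ≠ ∞) ∧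
          ∫⁻ x, g x * ENNReal.ofReal (w x) ∂m ≠ ∞ ∧
          ∀ σ' : ℝ, 1 < σ' → σ' < 2 →
            I σ' = κ * ((∫⁻ x, g x * ENNReal.ofReal (w x ^ σ') ∂m).toReal : ℝ) *
              partialPairL S₀ (conjFamily β₀) β₀ σ') :
    JacquetShalika1981_partialPairL_pole_of_eq_conj (n := n) (K := K) (μ := μ) :=
  JacquetShalika1981_partialPairL_pole_of_eq_conj_of_real_moment_datum
    (fun P _ _ hα _ hv _ ha => norm_satakeParameter_lt_sqrt_of_le_two h2 P hα hv ha) hdat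

end Assembly

end Literature.NumberTheory.Automorphic
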